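import Summits.AtomisticToContinuum.HydrodynamicLimit.Theses.RelayRaceLocality

/-!
# `ConeLocalisation` (stmt-AtomisticToContinuum-12504): the packing guard of its consequent `S` is not
# load-bearing

Negative helper file of the standing crux disprover (`Cruxes/ConeLocalisation/Disproof.lean` §2;
refuter-cdisprove-stmt-AtomisticToContinuum-12504-0, 2026-08-17). No Theses declaration is asserted.

`S`, the consequent of `ConeLocalisation` (= antecedent of `RestartPrinciple`, stmt-12503), has prefix
`∃ η₀ ∀ M ∃ τ₁ ∀ profile ∃ σ₀ ∀ σ < σ₀` and, among its guards on `[0, t]`, BOTH the packing clause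
`ρ s x * σ ^ 3 < η₀` and the size clause `ρ s x ≤ M`. Since `σ₀` is chosen AFTER `M`, shrinking it to
`min σ₀ (min 1 (η₀ / (M + 1)))` makes the packing clause a consequence of the size clause
(`packing_of_size`). Hence

* `shortTimeGuardedHL_iff_sizeGuardedHL : S ↔ S₀`, where `S₀` is `S` with the packing clause and the
  outer `∃ η₀` deleted (prefix `∀ M ∃ τ₁ ∀ profile ∃ σ₀ ∀ σ < σ₀`);
* `coneLocalisation_imp_sizeGuarded : ConeLocalisation → (LightConeInLaw → NearConstantShortTimeHL → S₀)`
  (the converse, equally trivial, would assert the route item and is left to provers: prove `S₀`, get `S`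
  by `shortTimeGuardedHL_iff_sizeGuardedHL.2`).

Information for provers (they may ignore the packing clause on both sides) and for planners restating
`S` (the density-floor repair of the ideators): the clause and `η₀` can be dropped from `S` altogether. It is
NOT vestigial in the summit conjunct `G`, whose `σ₀` precedes `∀ T ∀ solution` with no size guard.
-/

namespace Summit.AtomisticToContinuum.HydrodynamicLimit.Theorems.ConeLocalisationNegative

open Literature.MathematicalPhysics.KineticTheory Literature.Analysis.FluidPDE
open Literature.Analysis.FunctionSpaces MeasureTheory Filter Set
open Summit.AtomisticToContinuum.HydrodynamicLimit.Theses.RelayRaceLocality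

/-- Arithmetic: `0 < σ < min 1 (η₀ / (M + 1))`, `r ≤ M`, `0 < M` give `r σ³ < η₀`. [folklore] -/
theorem packing_of_size {η₀ M σ r : ℝ} (hM : 0 < M) (hσ : 0 < σ) (hσ1 : σ < 1)
    (hσe : σ < η₀ / (M + 1)) (hr : r ≤ M) : r * σ ^ 3 < η₀ := by
  have hσ3 : σ ^ 3 ≤ σ := by nlinarith [sq_nonneg σ, mul_pos hσ hσ]
  have h1 : r * σ ^ 3 ≤ M * σ ^ 3 := mul_le_mul_of_nonneg_right hr (by positivity)
  have h2 : M * σ ^ 3 ≤ M * σ := mul_le_mul_of_nonneg_left hσ3 hM.le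
  have h3 : M * σ < M * (η₀ / (M + 1)) := mul_lt_mul_of_pos_left hσe hM
  have hM1 : (0 : ℝ) < M + 1 := by linarith
  have hη₀ : 0 < η₀ := by
    have : 0 < η₀ / (M + 1) := lt_trans hσ hσe
    exact (div_pos_iff_of_pos_right hM1).1 this
  have h4 : M * (η₀ / (M + 1)) ≤ η₀ := by
    rw [mul_div_assoc', div_le_iff₀ hM1]
    nlinarith
  linarith

/-- **The packing guard of `S` is not load-bearing**: `S ↔ S₀` (`S₀` = `S` without `ρ s x * σ ^ 3 < η₀`
and without `η₀`). `→`: shrink `σ₀`; `←`: take `η₀ := 1` and forget the clause. [folklore] -/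
theorem shortTimeGuardedHL_iff_sizeGuardedHL :
    (∃ η₀ : ℝ, 0 < η₀ ∧ ∀ M : ℝ, 0 < M → ∃ τ₁ : ℝ, 0 < τ₁ ∧ ∀ (a₀ θ₀ : T3 → ℝ) (u₀ : T3 → V3), Continuous a₀ → Continuous θ₀ → Continuous u₀ → (∀ x, 0 < a₀ x) → (∀ x, 0 < θ₀ x) → ∃ σ₀ : ℝ, 0 < σ₀ ∧ ∀ σ : ℝ, 0 < σ → σ < σ₀ → ∀ (T : ℝ) (ρ θ : ℝ → T3 → ℝ) (u : ℝ → T3 → V3), IsHardSphereEulerSolution σ T ρ u θ → ∀ Φ : (N : ℕ) → HardSphereFlow (Torus.geometry (Fin 3)) (hsDiameter σ N) (N + 1), TendstoHydroFieldsAt (fun N => localGibbsLaw σ a₀ u₀ θ₀ N (Φ N)) Φ ρ u θ 0 → ∀ t ∈ Set.Ico 0 (min T τ₁), (∀ s ∈ Set.Icc 0 t, ∀ x, ρ s x * σ ^ 3 < η₀ ∧ ρ s x ≤ M ∧ θ s x ≤ M ∧ M⁻¹ ≤ θ s x ∧ ‖u s x‖ ≤ M ∧ ∀ i j k : Fin 3,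 |Torus.partialDeriv i (ρ s) x| ≤ M ∧ ‖Torus.partialDeriv i (u s) x‖ ≤ M ∧ |Torus.partialDeriv i (θ s) x| ≤ M ∧ |Torus.partialDeriv i (Torus.partialDeriv j (ρ s)) x| ≤ M ∧ ‖Torus.partialDeriv i (Torus.partialDeriv j (u s)) x‖ ≤ M ∧ |Torus.partialDeriv i (Torus.partialDeriv j (θ s)) x| ≤ M ∧ |Torus.partialDeriv i (Torus.partialDeriv j (Torus.partialDeriv k (ρ s))) x| ≤ M ∧ ‖Torus.partialDeriv i (Torus.partialDeriv j (Torus.partialDeriv k (u s))) x‖ ≤ M ∧ |Torus.partialDeriv i (Torus.partialDeriv j (Torus.partialDeriv k (θ s))) x| ≤ M) → TendstoHydroFieldsAt (fun N => localGibbsLaw σ a₀ u₀ θ₀ N (Φ N)) Φ ρ u θ t) ↔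
    (∀ M : ℝ, 0 < M → ∃ τ₁ : ℝ, 0 < τ₁ ∧ ∀ (a₀ θ₀ : T3 → ℝ) (u₀ : T3 → V3), Continuous a₀ → Continuous θ₀ → Continuous u₀ → (∀ x, 0 < a₀ x) → (∀ x, 0 < θ₀ x) → ∃ σ₀ : ℝ, 0 < σ₀ ∧ ∀ σ : ℝ, 0 < σ → σ < σ₀ → ∀ (T : ℝ) (ρ θ : ℝ → T3 → ℝ) (u : ℝ → T3 → V3), IsHardSphereEulerSolution σ T ρ u θ → ∀ Φ : (N : ℕ) → HardSphereFlow (Torus.geometry (Fin 3)) (hsDiameter σ N) (N + 1), TendstoHydroFieldsAt (fun N => localGibbsLaw σ a₀ u₀ θ₀ N (Φ N)) Φ ρ u θ 0 → ∀ t ∈ Set.Ico 0 (min T τ₁), (∀ s ∈ Set.Icc 0 t, ∀ x, ρ s x ≤ M ∧ θ s x ≤ M ∧ M⁻¹ ≤ θ s x ∧ ‖u s x‖ ≤ M ∧ ∀ i j k : Fin 3, |Torus.partialDeriv i (ρ s) x| ≤ M ∧ ‖Torus.partialDeriv i (u s) x‖ ≤ M ∧ |Torus.partialDeriv i (θ s)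 x| ≤ M ∧ |Torus.partialDeriv i (Torus.partialDeriv j (ρ s)) x| ≤ M ∧ ‖Torus.partialDeriv i (Torus.partialDeriv j (u s)) x‖ ≤ M ∧ |Torus.partialDeriv i (Torus.partialDeriv j (θ s)) x| ≤ M ∧ |Torus.partialDeriv i (Torus.partialDeriv j (Torus.partialDeriv k (ρ s))) x| ≤ M ∧ ‖Torus.partialDeriv i (Torus.partialDeriv j (Torus.partialDeriv k (u s))) x‖ ≤ M ∧ |Torus.partialDeriv i (Torus.partialDeriv j (Torus.partialDeriv k (θ s))) x| ≤ M) → TendstoHydroFieldsAt (fun N => localGibbsLaw σ a₀ u₀ θ₀ N (Φ N)) Φ ρ u θ t) := by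
  constructor
  · rintro ⟨η₀, hη₀, H⟩ M hM
    obtain ⟨τ₁, hτ₁, H1⟩ := H M hM
    refine ⟨τ₁, hτ₁, fun a₀ θ₀ u₀ ha hθ hu ha0 hθ0 => ?_⟩
    obtain ⟨σ₀, hσ₀, H2⟩ := H1 a₀ θ₀ u₀ ha hθ hu ha0 hθ0
    refine ⟨min σ₀ (min 1 (η₀ / (M + 1))),
      lt_min hσ₀ (lt_min one_pos (div_pos hη₀ (by linarith))), ?_⟩
    intro σ hσ hσlt T ρ θ u hsol Φ h0 t ht hg
    have hσ₁ : σ < σ₀ := lt_of_lt_of_le hσlt (min_le_left _ _)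
    have hσ1 : σ < 1 := lt_of_lt_of_le hσlt ((min_le_right _ _).trans (min_le_left _ _))
    have hσe : σ < η₀ / (M + 1) := lt_of_lt_of_le hσlt ((min_le_right _ _).trans (min_le_right _ _))
    refine H2 σ hσ hσ₁ T ρ θ u hsol Φ h0 t ht fun s hs x => ?_
    obtain ⟨g1, g2⟩ := hg s hs x
    exact ⟨packing_of_size hM hσ hσ1 hσe g1, g1, g2⟩
  · intro H
    refine ⟨1, one_pos, fun M hM => ?_⟩
    obtain ⟨τ₁, hτ₁, H1⟩ := H M hM
    refine ⟨τ₁, hτ₁, fun a₀ θ₀ u₀ ha hθ hu ha0 hθ0 => ?_⟩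
    obtain ⟨σ₀, hσ₀, H2⟩ := H1 a₀ θ₀ u₀ ha hθ hu ha0 hθ0
    exact ⟨σ₀, hσ₀, fun σ hσ hσ₁ T ρ θ u hsol Φ h0 t ht hg =>
      H2 σ hσ hσ₁ T ρ θ u hsol Φ h0 t ht fun s hs x => (hg s hs x).2⟩

/-- Hence the crux entails its packing-free reading (and conversely, by `.2` of the iff, a proof of the
packing-free reading proves the crux). [folklore] -/
theorem coneLocalisation_imp_sizeGuarded (h : ConeLocalisation) :
    LightConeInLaw → NearConstantShortTimeHL →
    (∀ M : ℝ, 0 < M → ∃ τ₁ : ℝ, 0 < τ₁ ∧ ∀ (a₀ θ₀ : T3 → ℝ) (u₀ : T3 → V3), Continuous a₀ → Continuous θ₀ → Continuous u₀ → (∀ x, 0 < a₀ x) → (∀ x, 0 < θ₀ x) → ∃ σ₀ : ℝ, 0 < σ₀ ∧ ∀ σ : ℝ, 0 < σ → σ < σ₀ → ∀ (T : ℝ) (ρ θ : ℝ → T3 → ℝ) (u : ℝ → T3 → V3), IsHardSphereEulerSolution σ T ρ u θ → ∀ Φ : (N : ℕ) → HardSphereFlow (Torus.geometry (Fin 3))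 (hsDiameter σ N) (N + 1), TendstoHydroFieldsAt (fun N => localGibbsLaw σ a₀ u₀ θ₀ N (Φ N)) Φ ρ u θ 0 → ∀ t ∈ Set.Ico 0 (min T τ₁), (∀ s ∈ Set.Icc 0 t, ∀ x, ρ s x ≤ M ∧ θ s x ≤ M ∧ M⁻¹ ≤ θ s x ∧ ‖u s x‖ ≤ M ∧ ∀ i j k : Fin 3, |Torus.partialDeriv i (ρ s) x| ≤ M ∧ ‖Torus.partialDeriv i (u s) x‖ ≤ M ∧ |Torus.partialDeriv i (θ s) x| ≤ M ∧ |Torus.partialDeriv i (Torus.partialDeriv j (ρ s)) x| ≤ M ∧ ‖Torus.partialDeriv i (Torus.partialDeriv j (u s)) x‖ ≤ M ∧ |Torus.partialDeriv i (Torus.partialDeriv j (θ s)) x| ≤ M ∧ |Torus.partialDeriv i (Torus.partialDeriv j (Torus.partialDeriv k (ρ s))) x| ≤ M ∧ ‖Torus.partialDeriv i (Torus.partialDeriv j (Torus.partialDeriv k (u s))) x‖ ≤ M ∧ |Torus.partialDeriv i (Torus.partialDeriv j (Torus.partialDeriv k (θ s))) x| ≤ M) → TendstoHydroFieldsAt (fun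 N => localGibbsLaw σ a₀ u₀ θ₀ N (Φ N)) Φ ρ u θ t) :=
  fun hA hB => shortTimeGuardedHL_iff_sizeGuardedHL.1 (h hA hB)

end Summit.AtomisticToContinuum.HydrodynamicLimit.Theorems.ConeLocalisationNegative
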